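import Summits.QuantumFields.BalabanUV.Beta.FP.GhostMixTwoLeg
import Summits.QuantumFields.BalabanUV.Beta.FP.BondFamilyCovariance

/-!
# `Beta/FP/GhostMixPieces` — road «FP» (binder row D1), row KER-γ (α2) sub-row **α2-c** «GHOST», PART 2a: THE (MIX-2) GHOST PIECE OF THE JUNCTION — the
# windowed `(c, e)`-table as a DATA def, its joint `N`-block periodicity under DISPLAYED covariance letters, its (hk) shape, entry bound and LEDGER LINE
# (the `hgh`∕`hGgh`∕`hLgh` members of the owner's (LEDGER) skeleton `FineHessianNearLedger.hasym_PiBF_vertex2OfK_of_sliceLedger`, p253803, for this piece), by name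
# over `FineSplitJunctionTwoLeg.rem_of_twoLeg` — the ghost twin of leaf-01's `BlockTermsPieces` (α2-a PART 2)

HONEST DEPENDENCY (page 1, mandatory): continuum YM on T⁴ ⇐ BetaPertH ∧ nine spine estimates (0/9 proved); BetaPertH ⇐ (D1) ∧ (D4) ∧
CAP+tail; G-an2-4 gates asym, D1 and NE2/3/4.  HONEST FRAMING (cell contract, verbatim): «discharging `BetaPertH` makes Bałaban's UV
stability UNCONDITIONAL — a real constructive-QFT result; it is NOT the continuum limit and NOT the Clay problem.»  THIS MODULE is [our object] bookkeeping:
ONE data def (the windowed piece) over ABSTRACT constituents — the 0-form rooted block family with bond letters (`p`, `rad`), coarse windows `U`, offsets `W`, an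
inner leg `I` — every road letter DISPLAYED as a hypothesis: (radCov) the path rule is block covariant, (Ucov) the coarse windows are covariant, (Icov) the inner
leg is block covariant, (I) its decay letter, (U)(W) radius letters, (Msup) a sup letter of the vertex mass, and the junction's (Kcov)(col)(J)(J′); then [folklore]
plumbing BY NAME over `GhostMixTwoLeg.abs_mix2_twoLeg_le_mass` ∕ `windowedMass_bond_le` (p253304) and F's `FineSplitJunctionTwoLeg.rem_of_twoLeg` (p251473).
On the road `I := kerH (Lc^m − 1) a` ((I) = `GhostLoopCountingMixRate.ghostColumn_engineLetters_of_le` ✓; (Icov) is the (I-gh) lineage's to state), `N = Nw = Lc^m`,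
`U s` = the coarse ball of radius `R₀+1` about `s`, `W` = the fine ball of radius `(R₀+1)N`.  It asserts nothing about Bałaban's constrained objects, cites
nothing, mints no `Prop` fact, 0 sorry.  NOT the identification of the literal's ghost table with these pieces ((H2), displayed — `GhostNearSplit`), NOT
(LEDGER-gh)'s numbers, NOT hsplit, NOT D1, NOT BetaPertH, NOT continuum, NOT Clay.

ABSOLUTE RULE (cell charter, verbatim): «No internally-minted statement may enter as a cited fact. Every hypothesis is either kernel-proved in this
package or a verbatim quotation of a PUBLISHED theorem with page reference. The manuscript(s) under audit are NOT citable for their own disputed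
steps — they are the thing under adjudication; programme-internal (2001/route/tribunal) claims are never citable.»

CONTENT: §1 [our object] **`gmix2Piece`** (data def) + `gmix2Piece_apply`; §2 [folklore] **`isBlockPeriodic_gmix2Piece`** (`BondFamilyCovariance.ker₁_bond_shift`
BY NAME: the bond-letter jet kernel is block covariant under (radCov)); §3 [folklore] **`hk_gmix2Piece`**, **`bounded_gmix2Piece`**; §4 [folklore] **`ledger_gmix2Piece`** (the `hLgh` line).
Provenance: D1 formalisation swarm LEAF PROVER 05, unit `b2b-balaban-beta-d1-formalise-leaf-05` gen 15, 2026-08-21, road FP row KER-γ (α2) sub-row α2-c (owner GO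
R-FP-35 (a), words l.28227 «PART 2 THIS SHAPE», l.28436; R-FP-36 (b)); «not in print; our bookkeeping»; no existing file touched.
-/

noncomputable section

namespace Summit.QuantumFields.BalabanUV.Beta.FP.GhostMixPieces

open Finset Real
open scoped BigOperators
open Literature.MathematicalPhysics.QuantumFieldTheory.Balaban1983to89
open Literature.MathematicalPhysics.QuantumFieldTheory.Balaban1983to89.Beta
open ExpKernelCalculus (Site MKer shiftK)
open OneStepResolventKernel (Fib)
open OneStepKernelFamily (colH)
open DyadicShell (Pt supNorm)
open AxialBlockWeights (fineBlock)
open Summit.QuantumFields.BalabanUV.Beta.D1BFx.MomentTransferPeriodic (IsBlockPeriodic)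
open Summit.QuantumFields.BalabanUV.Beta.D1BFx.MomentTransferPeriodicEntry (EKer₂ dressedEntryP)
open Summit.QuantumFields.BalabanUV.Beta.FP.TransportInfinityM (colOf)
open Summit.QuantumFields.BalabanUV.Beta.FP.AveragingJetLettersRooted (ker₁)
open Summit.QuantumFields.BalabanUV.Beta.FP.ScalarAveragingJetLetters (sclW sclFld sclBg)
open Summit.QuantumFields.BalabanUV.Beta.FP.GhostMixTwoLeg (abs_mix2_twoLeg_le_mass windowedMass_bond_le)
open Summit.QuantumFields.BalabanUV.Beta.FP.FineSplitJunctionTwoLeg (rem_of_twoLeg)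
open Summit.QuantumFields.BalabanUV.Beta.FP.BondFamilyCovariance (ker₁_bond_shift)

variable {σ : Type*} [Fintype σ]

/-! ## §1 The windowed (MIX-2) ghost piece -/

/-- [our object] **THE WINDOWED (MIX-2) GHOST PIECE** of the junction's near table: the `(c, e)` entry at fine points `(s, s′)` is the (MIX-2) word — first vertex
the direction-`c` averaging jet at `s` (bond-letter 0-form family `(p, rad)` at blocking `N`), second the direction-`e` jet at `s′`, inner legs `I` from each
vertex's field point to the OTHER vertex's root block — summed over the coarse windows `U s`, `U s′` and the offset window `W`, and CUT OFF at the near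
window `‖s′ − s‖∞ ≤ Nw`. -/
def gmix2Piece (N : ℕ) (p : σ → ℝ) (rad : σ → Pt → Pt → List (Pt × Fin 4)) (U : Pt → Finset Pt) (W : Finset Pt)
    (I : Pt → Pt → ℝ) (Nw : ℕ) : EKer₂ 4 :=
  fun c e s s' => if supNorm (s' - s) ≤ Nw then
    ∑ u ∈ U s, ∑ u' ∈ U s', (∑ w ∈ W, ker₁ (sclW N p) (sclFld N u) (sclBg N u rad) (s, c) (s + w) * I (s + w) u') *
      (∑ w' ∈ W, ker₁ (sclW N p) (sclFld N u') (sclBg N u' rad) (s', e) (s' + w') * I (s' + w') u) else 0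

/-- [our object] the piece, unfolded. -/
theorem gmix2Piece_apply (N : ℕ) (p : σ → ℝ) (rad : σ → Pt → Pt → List (Pt × Fin 4)) (U : Pt → Finset Pt) (W : Finset Pt)
    (I : Pt → Pt → ℝ) (Nw : ℕ) (c e : Fin 4) (s s' : Pt) :
    gmix2Piece N p rad U W I Nw c e s s' = if supNorm (s' - s) ≤ Nw then
      ∑ u ∈ U s, ∑ u' ∈ U s', (∑ w ∈ W, ker₁ (sclW N p) (sclFld N u) (sclBg N u rad) (s, c) (s + w) * I (s + w) u') *
        (∑ w' ∈ W, ker₁ (sclW N p) (sclFld N u') (sclBg N u' rad) (s', e) (s' + w') * I (s' + w') u) else 0 := rfl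

/-! ## §2 Block covariance of the constituents and the joint block periodicity of the piece -/

section Periodicity

variable {N : ℕ} {p : σ → ℝ} {rad : σ → Pt → Pt → List (Pt × Fin 4)}

/-- [folklore] **THE (MIX-2) GHOST PIECE IS JOINTLY `N`-BLOCK PERIODIC** (the `hGper` binder of `rem_of_twoLeg`) under (radCov), the coarse-window covariance
(Ucov) `U (b + N•t) = (U b) + t` and the inner-leg covariance (Icov) `I (x + N•t) (u + t) = I x u`. -/
theorem isBlockPeriodic_gmix2Piece
    (hradCov : ∀ (s : σ) (u t x' : Pt), rad s (u + t) x' = (rad s u x').map (fun ℓ => (ℓ.1 + (N : ℤ) • t, ℓ.2)))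
    {U : Pt → Finset Pt} (hUcov : ∀ b t : Pt, U (b + (N : ℤ) • t) = (U b).image (· + t))
    {I : Pt → Pt → ℝ} (hIcov : ∀ x u t : Pt, I (x + (N : ℤ) • t) (u + t) = I x u)
    (W : Finset Pt) (Nw : ℕ) (c e : Fin 4) :
    IsBlockPeriodic N (gmix2Piece N p rad U W I Nw c e) := by
  classical
  intro t s s'
  simp only [gmix2Piece_apply]
  have ew : supNorm (s' + (N : ℤ) • t - (s + (N : ℤ) • t)) = supNorm (s' - s) := by rw [add_sub_add_right_eq_sub]
  rw [ew, hUcov s t, hUcov s' t,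
    Finset.sum_image fun x _ y _ h => add_left_injective t h]
  refine if_congr Iff.rfl (Finset.sum_congr rfl fun u _ => ?_) rfl
  rw [Finset.sum_image fun x _ y _ h => add_left_injective t h]
  refine Finset.sum_congr rfl fun u' _ => ?_
  have e1 : ∀ w, s + (N : ℤ) • t + w = s + w + (N : ℤ) • t := fun w => add_right_comm _ _ _
  have e2 : ∀ w', s' + (N : ℤ) • t + w' = s' + w' + (N : ℤ) • t := fun w' => add_right_comm _ _ _
  simp only [e1, e2, ker₁_bond_shift hradCov, hIcov]

end Periodicity

/-! ## §3 The pointwise shape and the entry bound -/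

section Shape

variable {N : ℕ} {p : σ → ℝ} {rad : σ → Pt → Pt → List (Pt × Fin 4)} {R₀ : ℕ} {U : Pt → Finset Pt} {W : Finset Pt}
  {I : Pt → Pt → ℝ} {C_I δ : ℝ}

/-- [folklore] **THE (hk) SHAPE OF THE (MIX-2) GHOST PIECE** (`GhostMixTwoLeg.abs_mix2_twoLeg_le_mass` BY NAME; the window cut-off only helps): under (U)(W) at
radius multiplier `R₀+1` and the inner-leg letter (I) `|I x u| ≤ C_I·e^{−(δ∕N)‖x − N•u‖∞}`, with the direction-`c` vertex mass
`M_c(s) = Σ_{u∈U s}Σ_{w∈W}|ker₁^{(u)}(s,c)(s+w)|`: `|gmix2Piece … c e s s′| ≤ M_c(s)·M_e(s′)·(C_I·e^{2(R₀+1)δ})²·e^{−(2δ∕N)‖s′−s‖∞}`. -/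
theorem hk_gmix2Piece (hδ : 0 < δ) (hN : 1 ≤ N)
    (hU : ∀ b, ∀ u ∈ U b, supNorm (b - (N : ℤ) • u) ≤ (R₀ + 1) * N) (hW : ∀ w ∈ W, supNorm w ≤ (R₀ + 1) * N)
    (hI : ∀ x u, |I x u| ≤ C_I * Real.exp (-(δ / N) * (supNorm (x - (N : ℤ) • u) : ℝ))) (Nw : ℕ) (c e : Fin 4) (s s' : Pt) :
    |gmix2Piece N p rad U W I Nw c e s s'|
      ≤ (∑ u ∈ U s, ∑ w ∈ W, |ker₁ (sclW N p) (sclFld N u) (sclBg N u rad) (s, c) (s + w)|) *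
        (∑ u' ∈ U s', ∑ w' ∈ W, |ker₁ (sclW N p) (sclFld N u') (sclBg N u' rad) (s', e) (s' + w')|) *
        ((C_I * Real.exp (2 * ((R₀ : ℝ) + 1) * δ)) * (C_I * Real.exp (2 * ((R₀ : ℝ) + 1) * δ))) *
        Real.exp (-(2 * δ / N) * (supNorm (s' - s) : ℝ)) := by
  have hmain := abs_mix2_twoLeg_le_mass (n := N) (R := R₀ + 1) (U := U) (W := W)
    (qd₁ := fun u b x => ker₁ (sclW N p) (sclFld N u) (sclBg N u rad) (b, c) x)
    (qd₂ := fun u b x => ker₁ (sclW N p) (sclFld N u) (sclBg N u rad) (b, e) x)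
    (I₁ := I) (I₂ := I) hδ hN hU hW hI hI s s'
  have e1 : (((R₀ + 1 : ℕ) : ℝ)) = (R₀ : ℝ) + 1 := by push_cast; ring
  rw [e1] at hmain
  rw [gmix2Piece_apply]
  split_ifs
  · exact hmain
  · rw [abs_zero]
    exact le_trans (abs_nonneg _) hmain

/-- [folklore] **ENTRY BOUND** (the `hGgh` binder): with a DISPLAYED sup letter (Msup) of the vertex masses `M_c(s) ≤ Msup`, every entry of the piece is bounded by
`Msup²·(C_I·e^{2(R₀+1)δ})²`. -/
theorem bounded_gmix2Piece (hδ : 0 < δ) (hN : 1 ≤ N)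
    (hU : ∀ b, ∀ u ∈ U b, supNorm (b - (N : ℤ) • u) ≤ (R₀ + 1) * N) (hW : ∀ w ∈ W, supNorm w ≤ (R₀ + 1) * N)
    (hI : ∀ x u, |I x u| ≤ C_I * Real.exp (-(δ / N) * (supNorm (x - (N : ℤ) • u) : ℝ)))
    {Msup : ℝ} (hMsup : ∀ (c : Fin 4) (s : Pt), ∑ u ∈ U s, ∑ w ∈ W, |ker₁ (sclW N p) (sclFld N u) (sclBg N u rad) (s, c) (s + w)| ≤ Msup)
    (Nw : ℕ) (c e : Fin 4) :
    ∃ A, ∀ s s', |gmix2Piece N p rad U W I Nw c e s s'| ≤ A := by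
  refine ⟨Msup * Msup * ((C_I * Real.exp (2 * ((R₀ : ℝ) + 1) * δ)) * (C_I * Real.exp (2 * ((R₀ : ℝ) + 1) * δ))), fun s s' => ?_⟩
  have h0 : ∀ (c : Fin 4) (s : Pt), 0 ≤ ∑ u ∈ U s, ∑ w ∈ W, |ker₁ (sclW N p) (sclFld N u) (sclBg N u rad) (s, c) (s + w)| :=
    fun c s => Finset.sum_nonneg fun _ _ => Finset.sum_nonneg fun _ _ => abs_nonneg _
  have hMsup0 : 0 ≤ Msup := (h0 c s).trans (hMsup c s)
  have hE : 0 ≤ (C_I * Real.exp (2 * ((R₀ : ℝ) + 1) * δ)) * (C_I * Real.exp (2 * ((R₀ : ℝ) + 1) * δ)) := by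
    have := mul_self_nonneg (C_I * Real.exp (2 * ((R₀ : ℝ) + 1) * δ)); exact this
  have hexp : Real.exp (-(2 * δ / N) * (supNorm (s' - s) : ℝ)) ≤ 1 := by
    apply Real.exp_le_one_iff.mpr
    have hN' : (0 : ℝ) < N := by exact_mod_cast hN
    have : (0 : ℝ) ≤ (supNorm (s' - s) : ℝ) := Nat.cast_nonneg _
    have : 0 ≤ 2 * δ / N * (supNorm (s' - s) : ℝ) := by positivity
    linarith
  set E : ℝ := (C_I * Real.exp (2 * ((R₀ : ℝ) + 1) * δ)) * (C_I * Real.exp (2 * ((R₀ : ℝ) + 1) * δ)) with hEdef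
  have h1 : (∑ u ∈ U s, ∑ w ∈ W, |ker₁ (sclW N p) (sclFld N u) (sclBg N u rad) (s, c) (s + w)|) *
      (∑ u' ∈ U s', ∑ w' ∈ W, |ker₁ (sclW N p) (sclFld N u') (sclBg N u' rad) (s', e) (s' + w')|) ≤ Msup * Msup :=
    mul_le_mul (hMsup c s) (hMsup e s') (h0 e s') hMsup0
  have h2 := mul_le_mul_of_nonneg_right h1 hE
  have h3 : 0 ≤ Msup * Msup * E := mul_nonneg (mul_nonneg hMsup0 hMsup0) hE
  calc |gmix2Piece N p rad U W I Nw c e s s'| ≤ _ := hk_gmix2Piece hδ hN hU hW hI Nw c e s s'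
    _ ≤ Msup * Msup * E * Real.exp (-(2 * δ / N) * (supNorm (s' - s) : ℝ)) := mul_le_mul_of_nonneg_right h2 (Real.exp_pos _).le
    _ ≤ Msup * Msup * E * 1 := mul_le_mul_of_nonneg_left hexp h3
    _ = _ := mul_one _

end Shape

/-! ## §4 The ledger line, by name over `FineSplitJunctionTwoLeg.rem_of_twoLeg` -/

section Ledger

variable {N : ℕ} {p : σ → ℝ} {rad : σ → Pt → Pt → List (Pt × Fin 4)} {ℓ₀ R₀ : ℕ} {U : Pt → Finset Pt} {W : Finset Pt}
  {I : Pt → Pt → ℝ} {C_I δ C_J C_J' : ℝ} {K : MKer (3 + 1) (Fib 3)} {a b : Fin 4}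

/-- **THE LEDGER LINE OF THE (MIX-2) GHOST PIECE** [folklore] (the `hLgh` binder of the (LEDGER) skeleton for this piece): `K` block-covariant with absolutely
summable END columns and the column letters (J) (anchor `0`) ∕ (J′) at rate `δ`; the bond family's letters (`p ≥ 0`, word length `≤ ℓ₀`, radius `R₀N`, (radCov));
(U)(Ucov), (W); the inner leg's (I)(Icov); the vertex-mass sup letter (Msup) ⟹ for every finite coarse `S′`,
`Σ_{u∈S′}‖u‖∞²·|dressedEntryP (colH K N · 0 ·) (gmix2Piece N p rad U W I Nw) (N•(−u)) a b| ≤ 16·(3·(1+20∕δ²)·(C_I·e^{2(R₀+1)δ})²·C_J·C_J′·A_M·A_M)`,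
`A_M = (ℓ₀·Σp)·e^{δR₀∕2}·(e^{δ∕2}(1+480e^{δ∕4}(4∕δ)⁴))` (`rem_of_twoLeg` with `M₁ c e := M_c`, `M₂ c e := M_e`, (A₁)(A₂) := `windowedMass_bond_le` BY NAME). -/
theorem ledger_gmix2Piece (hδ : 0 < δ) (hN : 1 ≤ N)
    (hKcov : ∀ t : Fin (3 + 1) → ℤ, shiftK (-((N : ℤ) • t)) K = K)
    (hcol : ∀ κ l : Fin 4, Summable fun x => |colOf K κ l x|)
    (hp : ∀ s, 0 ≤ p s) (hrad : ∀ s u x', (rad s u x').length ≤ ℓ₀)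
    (hradR : ∀ (s : σ) (u : Pt) (x : ↥(fineBlock N)) (ℓ : Pt × Fin 4), ℓ ∈ rad s u x.1 → supNorm (ℓ.1 - (N : ℤ) • u) ≤ R₀ * N)
    (hradCov : ∀ (s : σ) (u t x' : Pt), rad s (u + t) x' = (rad s u x').map (fun ℓ => (ℓ.1 + (N : ℤ) • t, ℓ.2)))
    (hU : ∀ b, ∀ u ∈ U b, supNorm (b - (N : ℤ) • u) ≤ (R₀ + 1) * N) (hUcov : ∀ b t : Pt, U (b + (N : ℤ) • t) = (U b).image (· + t))
    (hW : ∀ w ∈ W, supNorm w ≤ (R₀ + 1) * N)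
    (hI : ∀ x u, |I x u| ≤ C_I * Real.exp (-(δ / N) * (supNorm (x - (N : ℤ) • u) : ℝ)))
    (hIcov : ∀ x u t : Pt, I (x + (N : ℤ) • t) (u + t) = I x u)
    {Msup : ℝ} (hMsup : ∀ (c : Fin 4) (s : Pt), ∑ u ∈ U s, ∑ w ∈ W, |ker₁ (sclW N p) (sclFld N u) (sclBg N u rad) (s, c) (s + w)| ≤ Msup)
    (hJ : ∀ (c : Fin 4) (q : Pt), |colH K N a 0 c q| ≤ C_J * Real.exp (-(δ / N) * (supNorm (q - (N : ℤ) • (0 : Pt)) : ℝ)))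
    (hJ' : ∀ (e : Fin 4) (S' : Finset Pt) (x : Pt), ∑ u ∈ S', (1 + ((supNorm (x - (N : ℤ) • u) : ℝ) / N) ^ 2) * |colH K N b u e x| ≤ C_J')
    (Nw : ℕ) :
    ∀ S' : Finset Pt, ∑ u ∈ S', (supNorm u : ℝ) ^ 2 *
        |dressedEntryP (fun c a' => colH K N a' 0 c) (gmix2Piece N p rad U W I Nw) ((N : ℤ) • (-u)) a b|
      ≤ 16 * (3 * (1 + 20 / δ ^ 2) * ((C_I * Real.exp (2 * ((R₀ : ℝ) + 1) * δ)) * (C_I * Real.exp (2 * ((R₀ : ℝ) + 1) * δ))) * C_J * C_J' *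
          ((((ℓ₀ : ℕ) : ℝ) * ∑ s, p s) * Real.exp (δ * R₀ / 2) * (Real.exp (δ / 2) * (1 + 480 * Real.exp (δ / 4) * (4 / δ) ^ 4))) *
          ((((ℓ₀ : ℕ) : ℝ) * ∑ s, p s) * Real.exp (δ * R₀ / 2) * (Real.exp (δ / 2) * (1 + 480 * Real.exp (δ / 4) * (4 / δ) ^ 4)))) := by
  have hE₀ : 0 ≤ (C_I * Real.exp (2 * ((R₀ : ℝ) + 1) * δ)) * (C_I * Real.exp (2 * ((R₀ : ℝ) + 1) * δ)) := mul_self_nonneg _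
  exact rem_of_twoLeg (G := gmix2Piece N p rad U W I Nw)
    (M₁ := fun c _ s => ∑ u ∈ U s, ∑ w ∈ W, |ker₁ (sclW N p) (sclFld N u) (sclBg N u rad) (s, c) (s + w)|)
    (M₂ := fun _ e s' => ∑ u' ∈ U s', ∑ w' ∈ W, |ker₁ (sclW N p) (sclFld N u') (sclBg N u' rad) (s', e) (s' + w')|)
    hδ hN hKcov hcol (fun c e => isBlockPeriodic_gmix2Piece hradCov hUcov hIcov W Nw c e)
    (fun c e => bounded_gmix2Piece hδ hN hU hW hI hMsup Nw c e) hE₀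
    (fun _ _ _ => Finset.sum_nonneg fun _ _ => Finset.sum_nonneg fun _ _ => abs_nonneg _)
    (fun _ _ _ => Finset.sum_nonneg fun _ _ => Finset.sum_nonneg fun _ _ => abs_nonneg _)
    (fun c e s s' => hk_gmix2Piece hδ hN hU hW hI Nw c e s s')
    (fun c _ q A => windowedMass_bond_le hδ hN hp hrad hradR U W A c q)
    (fun _ e q A => windowedMass_bond_le hδ hN hp hrad hradR U W A e q) hJ hJ'

end Ledger

end Summit.QuantumFields.BalabanUV.Beta.FP.GhostMixPieces

end
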